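import Summits.KontsevichZagierPeriods.KontsevichZagierPeriods.Theses.GenericPointClass
import Literature.NumberTheory.Transcendental.KZGroundingRelations

/-!
# Crux `ExactDescentBox` (stmt-KontsevichZagierPeriods-4427) — birth skeleton, line `birth`

Route `GenericPointClass`, crux #4 (the ENGINE, "Theorem B on boxes"): on the open box
`∏ᵢ (aᵢ, bᵢ) ⊂ ℝⁿ⁺¹`, an integrand which is an explicit divergence `∑ᵢ ∂ᵢ Aᵢ` of `ℚ`-semialgebraic
potentials continuous on the closed box descends, inside `KZ.relations`, to the sum of the
`n + 1` face representations `[face box, Aᵢ(xᵢ = bᵢ) − Aᵢ(xᵢ = aᵢ)]`.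

## The line (three registered stubs + a kernel-checked assembly)

The finite-sum bookkeeping of rule (1b) is ALREADY in the tree
(`Literature.NumberTheory.Transcendental.KZ.of_sub_sum_integrand_mem_relations`), so the crux is,
modulo that theorem, the ONE-POTENTIAL statement `SingleCoordinateDescent` (descent along one
coordinate `i`). The skeleton cuts it into three genuine lemmas:

* `stub_closeLastCoordinate : CloseLastCoordinate` — closing the box in the LAST coordinate is a
  null modification: `[open box, f] − [band, f̃] ∈ relations` for some representation on the band
  `(open base box) × [a_last, b_last]` whose integrand agrees with `f` on the open box (rule (1a)
  with the two null faces; the integrand is extended by `0`, `IsSemialgebraicFunOn.union`; the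
  corners are algebraic because the box is `ℚ`-semialgebraic, cf. the proved
  `Summit.KontsevichZagierPeriods.GaussManinCertificates.KZStokesBox_proof`).
* `stub_newtonLeibnizBand : NewtonLeibnizBand` — ONE Newton–Leibniz move (rule (3)) on that band
  with primitive the potential `A` and constant sections `a_last ≤ b_last`: the band representation
  minus the face representation `[open face box, A(·, b_last) − A(·, a_last)]` is a relation
  (`Function.update z (Fin.last n) t = Fin.snoc (Fin.init z) t`, `Fin.insertNth (Fin.last n) = Fin.snoc`,
  `Fin.succAbove (Fin.last n) = Fin.castSucc`).
* `stub_transportToLast : LastCoordinateDescent → SingleCoordinateDescent` — transport of the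
  coordinate `i` to the last place by the coordinate permutation `e` with `e (last) = i`,
  `e (castSucc j) = i.succAbove j` (rule (2) with a permutation matrix, `|det| = 1`; cf. the proved
  `KZ.of_sub_of_mem_relations_perm` for integrand `1` and the swap lemmas of
  `KZLogCalculusProofs`); the face representation is unchanged because
  `(Fin.insertNth (Fin.last n) t y) ∘ e.symm = Fin.insertNth i t y`.

`lastCoordinateDescent_of` glues the first two stubs (sorry-free), and `ExactDescentBox_of` is the
kernel-checked assembly: split the integrand into the `n + 1` pieces `[box, ∂ᵢAᵢ]`
(`KZ.of_sub_sum_integrand_mem_relations`), descend each piece by `SingleCoordinateDescent`, and sum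
in `KZ.relations`. Sorries live ONLY in the three `stub_*` theorems.

Disproof used: none on file for this crux (`ledger crux ls`: no `Disproof.lean`); negatives index of
the summit has no statement about boxes/divergences.
-/

noncomputable section

open MeasureTheory Set
open Literature.NumberTheory.Transcendental

namespace Summit.KontsevichZagierPeriods.KontsevichZagierPeriods.Cruxes.ExactDescentBox.Birth

/-! ### The stub statements -/

/-- **Closing the last coordinate is a null modification.** For a representation `r` on the open
box `∏ⱼ (aⱼ, bⱼ) ⊂ ℝⁿ⁺¹` there is a representation `r₁` on the band
`{z | (z ∘ castSucc) ∈ open base box, z_last ∈ [a_last, b_last]}` (closed in the last coordinate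
only) whose integrand agrees with that of `r` on the open box, with `[r] − [r₁] ∈ relations`
(the two faces `z_last = a_last`, `z_last = b_last` are Lebesgue-null: rule (1a)). -/
def CloseLastCoordinate : Prop :=
  ∀ (n : ℕ) (a b : Fin (n + 1) → ℝ) (r : KZ.IntegralRep (n + 1)),
    (∀ j, a j < b j) →
    r.domain = {z | ∀ j, z j ∈ Set.Ioo (a j) (b j)} →
    ∃ r₁ : KZ.IntegralRep (n + 1),
      r₁.domain = {z | (∀ j : Fin n, z (Fin.castSucc j) ∈ Set.Ioo (a (Fin.castSucc j)) (b (Fin.castSucc j))) ∧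
          z (Fin.last n) ∈ Set.Icc (a (Fin.last n)) (b (Fin.last n))} ∧
      Set.EqOn r₁.integrand r.integrand r.domain ∧
      KZ.of r - KZ.of r₁ ∈ KZ.relations

/-- **One Newton–Leibniz move on the band.** On the band of `CloseLastCoordinate`, if the potential
`A` is `ℚ`-semialgebraic and continuous on the closed box and `t ↦ A (update z last t)` has
derivative `r₁.integrand z` at `z_last` for every `z` in the OPEN box, then `[r₁]` minus the face
representation `[open face box, A(·, b_last) − A(·, a_last)]` is a relation (rule (3) along the last
coordinate over the open base box, constant sections `a_last ≤ b_last`, primitive `A`). -/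
def NewtonLeibnizBand : Prop :=
  ∀ (n : ℕ) (a b : Fin (n + 1) → ℝ) (r₁ : KZ.IntegralRep (n + 1)) (A : (Fin (n + 1) → ℝ) → ℝ)
    (s : KZ.IntegralRep n),
    (∀ j, a j < b j) →
    r₁.domain = {z | (∀ j : Fin n, z (Fin.castSucc j) ∈ Set.Ioo (a (Fin.castSucc j)) (b (Fin.castSucc j))) ∧
        z (Fin.last n) ∈ Set.Icc (a (Fin.last n)) (b (Fin.last n))} →
    IsSemialgebraicFunOn ℚ {z | ∀ j, z j ∈ Set.Icc (a j) (b j)} A →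
    ContinuousOn A {z | ∀ j, z j ∈ Set.Icc (a j) (b j)} →
    (∀ z : Fin (n + 1) → ℝ, (∀ j, z j ∈ Set.Ioo (a j) (b j)) →
      HasDerivAt (fun t : ℝ => A (Function.update z (Fin.last n) t)) (r₁.integrand z)
        (z (Fin.last n))) →
    s.domain = {y | ∀ j, y j ∈ Set.Ioo (a (Fin.succAbove (Fin.last n) j))
        (b (Fin.succAbove (Fin.last n) j))} →
    Set.EqOn s.integrand (fun y => A (Fin.insertNth (Fin.last n) (b (Fin.last n)) y) -
        A (Fin.insertNth (Fin.last n) (a (Fin.last n)) y)) s.domain →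
    KZ.of r₁ - KZ.of s ∈ KZ.relations

/-- **Descent along the last coordinate** (glued from the two stubs above, sorry-free below): on the
open box, an integrand which is `∂A/∂z_last` for a potential `A` semialgebraic and continuous on the
closed box descends to the face representation `[open face box, A(·, b_last) − A(·, a_last)]`. -/
def LastCoordinateDescent : Prop :=
  ∀ (n : ℕ) (a b : Fin (n + 1) → ℝ) (r : KZ.IntegralRep (n + 1)) (A : (Fin (n + 1) → ℝ) → ℝ)
    (s : KZ.IntegralRep n),
    (∀ j, a j < b j) →
    r.domain = {z | ∀ j, z j ∈ Set.Ioo (a j) (b j)} →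
    IsSemialgebraicFunOn ℚ {z | ∀ j, z j ∈ Set.Icc (a j) (b j)} A →
    ContinuousOn A {z | ∀ j, z j ∈ Set.Icc (a j) (b j)} →
    (∀ z ∈ r.domain, HasDerivAt (fun t : ℝ => A (Function.update z (Fin.last n) t))
      (r.integrand z) (z (Fin.last n))) →
    s.domain = {y | ∀ j, y j ∈ Set.Ioo (a (Fin.succAbove (Fin.last n) j))
        (b (Fin.succAbove (Fin.last n) j))} →
    Set.EqOn s.integrand (fun y => A (Fin.insertNth (Fin.last n) (b (Fin.last n)) y) -
        A (Fin.insertNth (Fin.last n) (a (Fin.last n)) y)) s.domain →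
    KZ.of r - KZ.of s ∈ KZ.relations

/-- **Descent along one coordinate `i`** — the one-potential form of the crux: on the open box, an
integrand which is `∂A/∂zᵢ` for a potential `A` semialgebraic and continuous on the closed box
descends to the face representation `[open face box, A(zᵢ = bᵢ) − A(zᵢ = aᵢ)]`. -/
def SingleCoordinateDescent : Prop :=
  ∀ (n : ℕ) (i : Fin (n + 1)) (a b : Fin (n + 1) → ℝ) (r : KZ.IntegralRep (n + 1))
    (A : (Fin (n + 1) → ℝ) → ℝ) (s : KZ.IntegralRep n),
    (∀ j, a j < b j) →
    r.domain = {z | ∀ j, z j ∈ Set.Ioo (a j) (b j)} →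
    IsSemialgebraicFunOn ℚ {z | ∀ j, z j ∈ Set.Icc (a j) (b j)} A →
    ContinuousOn A {z | ∀ j, z j ∈ Set.Icc (a j) (b j)} →
    (∀ z ∈ r.domain, HasDerivAt (fun t : ℝ => A (Function.update z i t)) (r.integrand z) (z i)) →
    s.domain = {y | ∀ j, y j ∈ Set.Ioo (a (Fin.succAbove i j)) (b (Fin.succAbove i j))} →
    Set.EqOn s.integrand (fun y => A (Fin.insertNth i (b i) y) - A (Fin.insertNth i (a i) y))
      s.domain →
    KZ.of r - KZ.of s ∈ KZ.relations

/-! ### Registered stubs (the ONLY sorries of this file) -/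

/-- Stub 1: closing the last coordinate is a null modification (rule (1a); integrand extended by
`0` to the two null faces, corners algebraic since the box is `ℚ`-semialgebraic). Size M. -/
theorem stub_closeLastCoordinate : CloseLastCoordinate := by
  sorry

/-- Stub 2: one Newton–Leibniz move on the band (rule (3), primitive `A`, constant sections).
Size M. -/
theorem stub_newtonLeibnizBand : NewtonLeibnizBand := by
  sorry

/-- Stub 3: transporting coordinate `i` to the last place is a change of variables (rule (2) with
the permutation matrix of `e`, `e last = i`, `e (castSucc j) = i.succAbove j`, `|det| = 1`); all
hypotheses and the face representation are invariant. Size M. -/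
theorem stub_transportToLast : LastCoordinateDescent → SingleCoordinateDescent := by
  sorry

/-! ### Sorry-free glue -/

/-- Descent along the last coordinate from stubs 1 and 2. -/
theorem lastCoordinateDescent_of (h₁ : CloseLastCoordinate) (h₂ : NewtonLeibnizBand) :
    LastCoordinateDescent := by
  intro n a b r A s hab hdom hA hAc hder hsd hsi
  obtain ⟨r₁, hr₁d, hr₁i, hrel⟩ := h₁ n a b r hab hdom
  have hder₁ : ∀ z : Fin (n + 1) → ℝ, (∀ j, z j ∈ Set.Ioo (a j) (b j)) →
      HasDerivAt (fun t : ℝ => A (Function.update z (Fin.last n) t)) (r₁.integrand z)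
        (z (Fin.last n)) := by
    intro z hz
    have hz' : z ∈ r.domain := by
      rw [hdom]
      exact hz
    rw [hr₁i hz']
    exact hder z hz'
  have h := h₂ n a b r₁ A s hab hr₁d hA hAc hder₁ hsd hsi
  have heq : KZ.of r - KZ.of s = (KZ.of r - KZ.of r₁) + (KZ.of r₁ - KZ.of s) := by abel
  rw [heq]
  exact KZ.relations.add_mem hrel h

/-- Descent along any coordinate from the three stubs. -/
theorem singleCoordinateDescent_of (h₁ : CloseLastCoordinate) (h₂ : NewtonLeibnizBand)
    (h₃ : LastCoordinateDescent → SingleCoordinateDescent) : SingleCoordinateDescent :=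
  h₃ (lastCoordinateDescent_of h₁ h₂)

/-! ### The assembly: the crux BY NAME from the three stub statements -/

/-- **Assembly.** `CloseLastCoordinate → NewtonLeibnizBand → (LastCoordinateDescent →
SingleCoordinateDescent) → ExactDescentBox`: split `[box, ∑ᵢ ∂ᵢAᵢ]` into the pieces `[box, ∂ᵢAᵢ]`
(iterated rule (1b), `KZ.of_sub_sum_integrand_mem_relations`), descend each piece along its own
coordinate, and add up in `KZ.relations`. -/
theorem ExactDescentBox_of (h₁ : CloseLastCoordinate) (h₂ : NewtonLeibnizBand)
    (h₃ : LastCoordinateDescent → SingleCoordinateDescent) :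
    Summit.KontsevichZagierPeriods.KontsevichZagierPeriods.Theses.GenericPointClass.ExactDescentBox := by
  have hS : SingleCoordinateDescent := singleCoordinateDescent_of h₁ h₂ h₃
  intro n a b r A A' s hab hdom hA hAc hder hA' hint hsum hsd hsi
  -- the per-coordinate pieces `[box, ∂ᵢ Aᵢ]`
  let R : Fin (n + 1) → KZ.IntegralRep (n + 1) := fun i =>
    { domain := r.domain
      integrand := A' i
      isSemialgebraic_domain := r.isSemialgebraic_domain
      isSemialgebraicFunOn_integrand := hA' i
      integrableOn := hint i }
  have hsplit : KZ.of r - ∑ i, KZ.of (R i) ∈ KZ.relations :=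
    KZ.of_sub_sum_integrand_mem_relations Finset.univ R r (fun _ _ => rfl)
      (fun z hz => by simpa [R] using hsum hz)
  have hdesc : ∀ i, KZ.of (R i) - KZ.of (s i) ∈ KZ.relations := fun i =>
    hS n i a b (R i) (A i) (s i) hab hdom (hA i) (hAc i) (hder i) (hsd i) (hsi i)
  have heq : KZ.of r - ∑ i, KZ.of (s i) =
      (KZ.of r - ∑ i, KZ.of (R i)) + ∑ i, (KZ.of (R i) - KZ.of (s i)) := by
    rw [Finset.sum_sub_distrib]
    abel
  rw [heq]
  exact KZ.relations.add_mem hsplit (sum_mem fun i _ => hdesc i)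

/-- The crux from the registered stubs (uses the three `sorry`s above through the assembly; kept
as a type-level check that the stub signatures are exactly the assembly's hypotheses). -/
theorem ExactDescentBox_of_stubs :
    Summit.KontsevichZagierPeriods.KontsevichZagierPeriods.Theses.GenericPointClass.ExactDescentBox :=
  ExactDescentBox_of stub_closeLastCoordinate stub_newtonLeibnizBand stub_transportToLast

end Summit.KontsevichZagierPeriods.KontsevichZagierPeriods.Cruxes.ExactDescentBox.Birth
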